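import Summits.FinalStateConjecture.FinalStateConjecture.Theorems.SwallowTheDatumKerrShieldedDataExistCapMap
import Summits.FinalStateConjecture.FinalStateConjecture.Theorems.KerrShieldedDataExist.Negative.SliceClause
import HarnessLib

/-!
# `KerrShieldedDataExist`, line `plug-the-second-sheet` (skeleton v4 "KerrCap") — stub `stub_capFarH`, II:
# the Kerr–Schild data at a point of the cap and the far-zone profile derivatives

Support file (`--supports stmt-FinalStateConjecture-10055`; everything proved, no definitions, no named facts)
for the registered stub `stub_capFarH` of `Cruxes/KerrShieldedDataExist/Lines/plug_the_second_sheet.lean`.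

For profiles `(τ, ϱ, α)` which on `s ≥ σ₅` are the quasi-isotropic Boyer–Lindquist reading of the bent
Kerr–Schild leaf — `ϱ(s) = s + M + (M² − a²)/4s`, `τ = T_{M,a}(ϱ) + c` (`T′ = 2Mr/Δ` beyond `8M`),
`α = (a/(r₊ − r₋)) log((ϱ − r₊)/(ϱ − r₋))` (`α′ = (a/Δ)ϱ′`) — the cap map `Φ(u) = (τ(s), X u)`,
`X u = L_{ϱ(s)} Rot_z(α(s)) (u/s)`, pulls the Kerr–Schild metric `g = η + 2Hℓ ⊗ ℓ` back to

  `h_u(v, w) = (Σ/s²) ⟪v, w⟫ + a²(r² + 2Mr + a²μ²)/(Σ s⁴) · (u₀v₁ − u₁v₀)(u₀w₁ − u₁w₀)`,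
  `r = ϱ(s)`, `μ = u₂/s`, `Σ = r² + a²μ²`,

for EVERY `u` with `‖u‖ > σ₅` (axis included: the computation is Cartesian throughout). Contents:

* `KerrCap.nullCovector_capImm`, `KerrCap.scalarH_capImm` — the Kerr–Schild data at `X u`: `ℓ⃗ = Rot_z(α)u/s`,
  `H = Mrs²/(r²s² + a²u₂²)`;
* `KerrCap.deriv_far_rho/tau/alpha` — `ϱ′ = 1 − (M² − a²)/4s²`, `τ′ = (2Mr/Δ)ϱ′`, `α′ = (a/Δ)ϱ′` on `s > σ₅`,
  and `KerrCap.rPlus_lt_far` (`ϱ > r₊` on the far zone).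

The closed form itself is assembled from these and the scalar identities of `…CapFarAlgebra.lean` in
`…StubCapFarH.lean` (`KerrCap.bilin_fderiv_capFar`, `KerrCap.inducedBilin_capFar`).

References: Brandt–Seidel, PRD 54 (1996) 1403, §II; Visser arXiv:0706.0622, (32)–(36); O'Neill 1983, Ch. 4.
-/

-- the doubled `FinalStateConjecture` path component is the summit/problem naming scheme, not a mistake
set_option linter.dupNamespace false

noncomputable section

open Set Function Filter Topology TopologicalSpace
open scoped Manifold ContDiff Topology InnerProductSpace
open Literature.Geometry.Lorentzian
open Summit.FinalStateConjecture.FinalStateConjecture.Theorems.KerrShieldedDataExist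

namespace Summit.FinalStateConjecture.FinalStateConjecture.Theorems.SwallowTheDatum

namespace KerrCap

/-! ### The Kerr–Schild data at a point of the cap -/

section Data

variable {ϱ α : ℝ → ℝ} {a : ℝ} {X : E3 → E3}
  (hX : ∀ u : E3, X u =
    !₂[(ϱ ‖u‖ * (Real.cos (α ‖u‖) * u 0 - Real.sin (α ‖u‖) * u 1) -
          a * (Real.sin (α ‖u‖) * u 0 + Real.cos (α ‖u‖) * u 1)) / ‖u‖,
       (ϱ ‖u‖ * (Real.sin (α ‖u‖) * u 0 + Real.cos (α ‖u‖) * u 1) +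
          a * (Real.cos (α ‖u‖) * u 0 - Real.sin (α ‖u‖) * u 1)) / ‖u‖,
       ϱ ‖u‖ * u 2 / ‖u‖])

include hX

/-- **The null covector at a point of the cap**: `ℓ_{X u}(t₀, y) = t₀ + ⟪Rot_z(α) u, y⟫/s`, i.e.
`ℓ⃗(X u) = Rot_z(α(s)) u/s` — the radial unit vector of Kerr's spheroidal parametrisation
(`(r x + a y)/(r² + a²) = P/s`, `(r y − a x)/(r² + a²) = Q/s`, `z/r = u₂/s` for `X u = L_r(P, Q, u₂)/s`).
Visser arXiv:0706.0622, (34). [cite: arXiv07060622, (34)] -/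
theorem nullCovector_capImm {u : E3} (hu : u ≠ 0) (hϱu : 0 < ϱ ‖u‖) (t t₀ : ℝ) (y : E3) :
    Kerr.nullCovector a (E4.ofTimeSpace t (X u)) (E4.ofTimeSpace t₀ y) =
      t₀ + ‖u‖⁻¹ * ((Real.cos (α ‖u‖) * u 0 - Real.sin (α ‖u‖) * u 1) * y 0 +
        (Real.sin (α ‖u‖) * u 0 + Real.cos (α ‖u‖) * u 1) * y 1 + u 2 * y 2) := by
  have hs : ‖u‖ ≠ 0 := norm_ne_zero_iff.2 hu
  have hr := radius_capMap hX hu hϱu t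
  have hr0 : ϱ ‖u‖ ≠ 0 := hϱu.ne'
  have hra : ϱ ‖u‖ ^ 2 + a ^ 2 ≠ 0 := by positivity
  have h1 : (E4.ofTimeSpace t (X u)) 1 = X u 0 := E4.ofTimeSpace_apply_succ t _ 0
  have h2 : (E4.ofTimeSpace t (X u)) 2 = X u 1 := E4.ofTimeSpace_apply_succ t _ 1
  have h3 : (E4.ofTimeSpace t (X u)) 3 = X u 2 := E4.ofTimeSpace_apply_succ t _ 2
  have k1 : (E4.ofTimeSpace t₀ y) 1 = y 0 := E4.ofTimeSpace_apply_succ t₀ _ 0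
  have k2 : (E4.ofTimeSpace t₀ y) 2 = y 1 := E4.ofTimeSpace_apply_succ t₀ _ 1
  have k3 : (E4.ofTimeSpace t₀ y) 3 = y 2 := E4.ofTimeSpace_apply_succ t₀ _ 2
  rw [Kerr.nullCovector, E4.covector_apply, Fin.sum_univ_four]
  simp only [Kerr.nullCovectorFun, hr, Fin.isValue, Matrix.cons_val_zero, Matrix.cons_val_one, Matrix.cons_val,
    E4.ofTimeSpace_apply_zero, one_mul]
  rw [h1, h2, h3, k1, k2, k3, capMap_apply_zero hX, capMap_apply_one hX, capMap_apply_two hX]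
  field_simp
  ring

/-- **The Kerr–Schild scalar at a point of the cap**: `H(X u) = Mr³/(r⁴ + a²z²) = Mrs²/(r²s² + a²u₂²)`
(`r = ϱ(s)`, `z = ru₂/s`), i.e. `H = Mr/Σ`, `Σ = r² + a²μ²`. Visser arXiv:0706.0622, (33). [cite: arXiv07060622, (33)] -/
theorem scalarH_capImm {M : ℝ} {u : E3} (hu : u ≠ 0) (hϱu : 0 < ϱ ‖u‖) (t : ℝ) :
    Kerr.scalarH M a (E4.ofTimeSpace t (X u)) =
      M * ϱ ‖u‖ * ‖u‖ ^ 2 / (ϱ ‖u‖ ^ 2 * ‖u‖ ^ 2 + a ^ 2 * u 2 ^ 2) := by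
  have hs : ‖u‖ ≠ 0 := norm_ne_zero_iff.2 hu
  have hs2 : (0 : ℝ) < ‖u‖ ^ 2 := by positivity
  have hr := radius_capMap hX hu hϱu t
  have h3 : (E4.ofTimeSpace t (X u)) 3 = X u 2 := E4.ofTimeSpace_apply_succ t _ 2
  have hden1 : ϱ ‖u‖ ^ 4 + a ^ 2 * (ϱ ‖u‖ * u 2 / ‖u‖) ^ 2 ≠ 0 := by positivity
  have hden2 : ϱ ‖u‖ ^ 2 * ‖u‖ ^ 2 + a ^ 2 * u 2 ^ 2 ≠ 0 := by positivity
  unfold Kerr.scalarH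
  rw [hr, h3, capMap_apply_two hX, div_eq_div_iff hden1 hden2]
  field_simp

end Data

/-! ### The far-zone profiles: derivatives -/

/-- `ϱ′(s) = 1 − (M² − a²)/4s²` for the quasi-isotropic radius `ϱ(s) = s + M + (M² − a²)/4s` on `s > σ₅ ≥ 0`
(locality of the derivative). [cite: BrandtSeidel1996, §II] -/
theorem deriv_far_rho {ϱ : ℝ → ℝ} {M a σ₅ s : ℝ} (hσ₅ : 0 < σ₅)
    (hfar : ∀ s, σ₅ ≤ s → ϱ s = s + M + (M ^ 2 - a ^ 2) / (4 * s)) (hs : σ₅ < s) :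
    deriv ϱ s = 1 - (M ^ 2 - a ^ 2) / (4 * s ^ 2) := by
  have hs0 : s ≠ 0 := (hσ₅.trans hs).ne'
  have hev : ϱ =ᶠ[𝓝 s] fun s ↦ s + M + (M ^ 2 - a ^ 2) / 4 * s⁻¹ := by
    filter_upwards [Ioi_mem_nhds hs] with s' hs'
    rw [hfar s' (le_of_lt hs')]
    ring
  have hd : HasDerivAt (fun s : ℝ ↦ s + M + (M ^ 2 - a ^ 2) / 4 * s⁻¹)
      (1 + (M ^ 2 - a ^ 2) / 4 * (-(s ^ 2)⁻¹)) s :=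
    ((hasDerivAt_id' s).add_const M).add ((hasDerivAt_inv hs0).const_mul _)
  rw [hev.deriv_eq, hd.deriv]
  field_simp
  ring

/-- `τ′(s) = T′(ϱ(s)) ϱ′(s) = (2Mr/Δ(r)) ϱ′(s)`, `r = ϱ(s) ≥ 8M`, for `τ = T_{M,a} ∘ ϱ + c` on `s > σ₅` (chain rule,
`Negative.hasDerivAt_bentHeight`, `Negative.bentSlope_eq_of_ge`). [folklore] -/
theorem deriv_far_tau {τ ϱ : ℝ → ℝ} {M a c σ₅ s : ℝ} (ha : |a| < M) (hϱ : ContDiff ℝ ∞ ϱ)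
    (hfar : ∀ s, σ₅ ≤ s → τ s = Negative.bentHeight M a (ϱ s) + c) (h8 : 8 * M ≤ ϱ s) (hs : σ₅ < s) :
    deriv τ s = 2 * M * ϱ s / (ϱ s ^ 2 - 2 * M * ϱ s + a ^ 2) * deriv ϱ s := by
  have hM := Negative.mass_pos ha
  have hdϱ : HasDerivAt ϱ (deriv ϱ s) s := (hϱ.differentiable (by simp)).differentiableAt.hasDerivAt
  have hev : τ =ᶠ[𝓝 s] fun s ↦ Negative.bentHeight M a (ϱ s) + c := by
    filter_upwards [Ioi_mem_nhds hs] with s' hs'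
    exact hfar s' (le_of_lt hs')
  have h1 : HasDerivAt (fun s ↦ Negative.bentHeight M a (ϱ s) + c)
      (Negative.bentSlope M a (ϱ s) * deriv ϱ s) s := by
    have hc : HasDerivAt (Negative.bentHeight M a ∘ ϱ) (Negative.bentSlope M a (ϱ s) * deriv ϱ s) s :=
      (Negative.hasDerivAt_bentHeight ha (ϱ s)).comp s hdϱ
    exact hc.add_const c
  rw [hev.deriv_eq, h1.deriv, Negative.bentSlope_eq_of_ge hM h8]

/-- `α′(s) = χ′(ϱ(s)) ϱ′(s) = (a/Δ(r)) ϱ′(s)` for the Boyer–Lindquist untwisting angle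
`α = (a/(r₊ − r₋)) log((ϱ − r₊)/(ϱ − r₋))` on `s > σ₅`, `ϱ(s) > r₊` (`Δ = (r − r₊)(r − r₋)`,
`Negative.delta_factor`). [folklore] -/
theorem deriv_far_alpha {α ϱ : ℝ → ℝ} {M a σ₅ s : ℝ} (ha : |a| < M) (hϱ : ContDiff ℝ ∞ ϱ)
    (hfar : ∀ s, σ₅ ≤ s → α s = a / (Kerr.rPlus M a - Kerr.rMinus M a) *
      Real.log ((ϱ s - Kerr.rPlus M a) / (ϱ s - Kerr.rMinus M a)))
    (hr : Kerr.rPlus M a < ϱ s) (hs : σ₅ < s) :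
    deriv α s = a / (ϱ s ^ 2 - 2 * M * ϱ s + a ^ 2) * deriv ϱ s := by
  have hpm : Kerr.rMinus M a < Kerr.rPlus M a := Negative.rMinus_lt_rPlus ha
  have hd : Kerr.rPlus M a - Kerr.rMinus M a ≠ 0 := (sub_pos.2 hpm).ne'
  have hp : 0 < ϱ s - Kerr.rPlus M a := sub_pos.2 hr
  have hm : 0 < ϱ s - Kerr.rMinus M a := by linarith
  have hdϱ : HasDerivAt ϱ (deriv ϱ s) s := (hϱ.differentiable (by simp)).differentiableAt.hasDerivAt
  have hev : α =ᶠ[𝓝 s] fun s ↦ a / (Kerr.rPlus M a - Kerr.rMinus M a) *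
      Real.log ((ϱ s - Kerr.rPlus M a) / (ϱ s - Kerr.rMinus M a)) := by
    filter_upwards [Ioi_mem_nhds hs] with s' hs'
    exact hfar s' (le_of_lt hs')
  have hq : HasDerivAt (fun s ↦ (ϱ s - Kerr.rPlus M a) / (ϱ s - Kerr.rMinus M a))
      ((deriv ϱ s * (ϱ s - Kerr.rMinus M a) - (ϱ s - Kerr.rPlus M a) * deriv ϱ s) /
        (ϱ s - Kerr.rMinus M a) ^ 2) s :=
    (hdϱ.sub_const _).div (hdϱ.sub_const _) hm.ne'
  have hlog := (hq.log (div_pos hp hm).ne').const_mul (a / (Kerr.rPlus M a - Kerr.rMinus M a))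
  rw [hev.deriv_eq, hlog.deriv, Negative.delta_factor ha]
  have hp' := hp.ne'
  have hm' := hm.ne'
  field_simp
  ring

/-- Along the far zone `σ₅ > √(M² − a²)/2`, whence `4s² > M² − a²` for `s ≥ σ₅`: otherwise the point
`s₀ = √(M² − a²)/2 ≥ σ₅` would have `ϱ(s₀) = M + √(M² − a²) = r₊ ≤ 2M`, contradicting `ϱ > 8M` there. In
particular `ϱ(s) > r₊` and `Δ(ϱ(s)) > 0` on the far zone. [folklore] -/
theorem rPlus_lt_far {ϱ : ℝ → ℝ} {M a σ₅ s : ℝ} (ha : |a| < M) (h8 : ∀ s, σ₅ ≤ s → 8 * M < ϱ s)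
    (hs : σ₅ ≤ s) : Kerr.rPlus M a < ϱ s := by
  have hM := Negative.mass_pos ha
  have h2 := Negative.rPlus_le_two_mul ha
  linarith [h8 s hs]

end KerrCap

/-- **Registered export of this file** (sub-goal `cap_farData` of stub `stub_capFarH`): the Kerr–Schild scalar at a
point of the cap, `KerrCap.scalarH_capImm`. [cite: arXiv07060622, (33)] -/
theorem cap_farData : ∀ {ϱ α : ℝ → ℝ} {a : ℝ} {X : E3 → E3}, (∀ u : E3, X u = !₂[(ϱ ‖u‖ * (Real.cos (α ‖u‖) * u 0 - Real.sin (α ‖u‖) * u 1) - a * (Real.sin (α ‖u‖) * u 0 + Real.cos (α ‖u‖) * u 1)) / ‖u‖, (ϱ ‖u‖ * (Real.sin (α ‖u‖) * u 0 + Real.cos (α ‖u‖) * u 1) + a * (Real.cos (α ‖u‖) * u 0 - Real.sin (α ‖u‖) * u 1)) / ‖u‖, ϱ ‖u‖ * u 2 / ‖u‖]) → ∀ {M : ℝ} {u : E3}, u ≠ 0 → 0 < ϱ ‖u‖ → ∀ (t : ℝ), Kerr.scalarH M a (E4.ofTimeSpace t (X u)) = M * ϱ ‖u‖ * ‖u‖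 ^ 2 / (ϱ ‖u‖ ^ 2 * ‖u‖ ^ 2 + a ^ 2 * u 2 ^ 2) :=
  fun hX _ _ hu hϱu t ↦ KerrCap.scalarH_capImm hX hu hϱu t

end Summit.FinalStateConjecture.FinalStateConjecture.Theorems.SwallowTheDatum

end
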